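import Summits.HodgeConjecture.HodgeConjecture.Theses.PadicSemiregularLift
import Literature.AlgebraicGeometry.HodgeTheory.AtiyahClassTraceReal
import Literature.AlgebraicGeometry.HodgeTheory.ChernCharacterBetti
import Literature.AlgebraicGeometry.HodgeTheory.WeilClasses
import Literature.AlgebraicGeometry.HodgeTheory.GlobalInvariantCycles
import Literature.AlgebraicGeometry.HodgeTheory.MotivatedClasses
import Literature.AlgebraicGeometry.HodgeTheory.FermatHypersurfaceReduction
import Literature.AlgebraicGeometry.HodgeTheory.ComplexConjugation
import Literature.AlgebraicGeometry.ModuliOfSheaves.MuStability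
import Literature.AlgebraicGeometry.Motives.FamiliesVHS
import Literature.AlgebraicGeometry.Motives.AbelianVariety
import Literature.AlgebraicGeometry.Motives.ChernClassesProofs
import Literature.AlgebraicGeometry.Motives.AbelianVarietyProjectiveChart
import Mathlib.AlgebraicGeometry.Morphisms.Smooth

/-!
# `stub_weilSectorSeeds` of line `symmetry-ladder-isotypic-obstructions` is false — kernel-checked
reduction to four printed theorems (cdisprove cycle 3, crux `HodgeAbelianVarieties`, stmt-HodgeConjecture-1333)

Negative lemma for the registered Stub 1 of the skeleton
`Cruxes/HodgeAbelianVarieties/Lines/symmetry-ladder-isotypic-obstructions.lean` (sha 782f9e98e2a6):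
`stub_weilSectorSeeds : ∃ T : ChernCharacterBetti, WeilSeeds[T]`. We prove, sorry-free,

  `h₁ → h₂ → h₃ → h₄ → ¬ ∃ T, WeilSeeds[T]`

where the four hypotheses are spelled out in the binder (no new named facts) and are theorems in
print / on paper (none is provable on the tree's real carriers today):

* `h₁` — the NO-GO THEOREM for `{0,1}`-semiregular sheaves (this cycle; Buchweitz–Flenner 2003
  Prop. 4.4 + Cor. 4.3 + the rigidity lemma `{y ∈ H^{q,q} : Sym²H^{0,1} ⌟ y = 0} = ℂθ^q`): on a scheme
  isomorphic to an abelian variety, with a polarisation class `θ`, a finite locally free `E` with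
  `(σ₀, σ₁)` injective and `T.ch₁ E ∈ ℂθ`, `T.ch₂ E ∈ ℂθ²` has every `T.ch_q E ∈ ℂθ^q`;
* `h₂` — FLATNESS of global classes over the connected base of an `AVFamily` (Ehresmann + `S(ℂ)`
  connected for `S` irreducible; rationality propagates by the `ℚ`-structure of `H*(𝒳(ℂ))`);
* `h₃` — the HYPERPLANE CLASS: an `AVFamily` of positive relative dimension (closed subfamily of
  `ℙᴺ × S`) carries a global degree-2 class restricting to a non-zero polarisation class on every fibre
  (hard Lefschetz for `𝒪(1)|`);
* `h₄` — a VERY GENERAL WEIL-TYPE SIXFOLD: `(A, φ)`, `φ² = -d`, with a non-zero rational `(3,3)` Weil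
  class, `B¹ = ℚθ` (for rational classes that are `(1,1)` or algebraic), `B² = ℚθ²`, every
  endomorphism pull-back of `θ` a multiple of `θ`, and `ℂθ³ ∩ (E₊ ⊕ E₋) = 0` (Weil 1977;
  van Geemen LNM 1594 Thm. 6.12: `SU(3,3)`-invariant theory).

The notations are VERBATIM copies of the skeleton's `local notation3` blocks (the display-only
parameter `S` of `SeedAt[…]`, unused in its expansion, is dropped; expansions are identical).
-/

noncomputable section

open CategoryTheory CategoryTheory.Limits AlgebraicGeometry MonoidalCategory
open Literature.AlgebraicGeometry Literature.AlgebraicGeometry.Motives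
  Literature.AlgebraicGeometry.HodgeTheory Literature.AlgebraicTopology.SingularHomology

namespace Summit.HodgeConjecture.HodgeConjecture.Theorems.HodgeAbelianVarieties.Negative

/-! ## Verbatim notations of the skeleton -/

local notation3 (prettyPrint := false) "Res[" f ", " s ", " k ", " A "]" =>
  complexBetti.map (Motives.fiberι f s) k A

local notation3 (prettyPrint := false) "AVFamily[" 𝒳 ", " S ", " f ", " n "]" =>
  (Motives.IsSmoothProjectiveFamily f n ∧
    (∃ (N : ℕ) (ι : 𝒳 ⟶ Motives.projectiveSpace N ℂ ⊗ S),
      IsClosedImmersion ι.left ∧ ι ≫ SemiCartesianMonoidalCategory.snd (Motives.projectiveSpace N ℂ) S = f) ∧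
    IsQuasiProjectiveOver S ∧ Smooth (S).hom ∧ IrreducibleSpace (S).left ∧
    (∀ s : Motives.ComplexPoints S, ∃ B : AbelianVariety ℂ, B.dim = n ∧ Nonempty (B.X ≅ Motives.fiberOver f s)))

local notation3 (prettyPrint := false) "FlatHodge[" f ", " n ", " p ", " A "]" =>
  (∀ s, IsRationalClass (Res[f, s, 2 * p, A]) ∧
    IsOfHodgeType n (Motives.fiberOver f s) (2 * p) p p (Res[f, s, 2 * p, A]))

local notation3 (prettyPrint := false) "DivPow[" 𝒳 ", " f ", " n ", " p "]" =>
  {x : complexBetti 𝒳 (2 * p) | ∃ h : complexBetti 𝒳 (2 * 1),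
    (∀ s, IsRationalClass (Res[f, s, 2 * 1, h]) ∧
      IsOfHodgeType n (Motives.fiberOver f s) (2 * 1) 1 1 (Res[f, s, 2 * 1, h])) ∧
    x = cupPowTwo h p}

local notation3 (prettyPrint := false) "SeedAt[" T ", " 𝒳 ", " f ", " n ", " p ", " G ", " z "]" =>
  (∃ (E : (Motives.fiberOver f z).left.Modules) (hE : Motives.IsFiniteLocallyFree E),
    IsZeroOneSemiregular hE ∧
    (∃ G₁ : complexBetti 𝒳 (2 * 1),
      (∀ s, IsOfHodgeType n (Motives.fiberOver f s) (2 * 1) 1 1 (Res[f, s, 2 * 1, G₁])) ∧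
      (T : ChernCharacterBetti).ch (Motives.fiberOver f z) E 1 = Res[f, z, 2 * 1, G₁]) ∧
    (∃ G₂ : complexBetti 𝒳 (2 * 2),
      (∀ s, IsOfHodgeType n (Motives.fiberOver f s) (2 * 2) 2 2 (Res[f, s, 2 * 2, G₂])) ∧
      (T : ChernCharacterBetti).ch (Motives.fiberOver f z) E 2 = Res[f, z, 2 * 2, G₂]) ∧
    (T : ChernCharacterBetti).ch (Motives.fiberOver f z) E p = Res[f, z, 2 * p, G])

local notation3 (prettyPrint := false) "Certified[" T ", " B ", " p ", " w "]" =>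
  (∃ (𝒳 S : Motives.SchemeOver ℂ) (f : 𝒳 ⟶ S) (s₁ : Motives.ComplexPoints S)
      (e : (B : AbelianVariety ℂ).X ≅ Motives.fiberOver f s₁) (W : complexBetti 𝒳 (2 * p)),
    AVFamily[𝒳, S, f, (B : AbelianVariety ℂ).dim] ∧ FlatHodge[f, (B : AbelianVariety ℂ).dim, p, W] ∧
    complexBetti.map e.hom (2 * p) (Res[f, s₁, 2 * p, W]) = w ∧
    ∃ (r : ℕ) (z : Fin r → Motives.ComplexPoints S) (G : Fin r → complexBetti 𝒳 (2 * p)),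
      (∀ j, SeedAt[T, 𝒳, f, (B : AbelianVariety ℂ).dim, p, G j, z j]) ∧
      W ∈ Submodule.span ℂ
        ({x : complexBetti 𝒳 (2 * p) | ∃ (j : Fin r) (u : 𝒳 ⟶ 𝒳), u ≫ f = f ∧
            x = complexBetti.map u (2 * p) (G j)} ∪ DivPow[𝒳, f, (B : AbelianVariety ℂ).dim, p]))

local notation3 (prettyPrint := false) "WeilSeeds[" T "]" =>
  (∀ (n d : ℕ), 2 ≤ n → 0 < d → ∀ (A : AbelianVariety ℂ) (φ : A ⟶ A), A.dim = 2 * n →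
    φ ≫ φ = -(d • 𝟙 A) → ∀ c ∈ weilClassesOf A φ n d, IsRationalClass c →
      IsOfHodgeType (2 * n) A.X (2 * n) n n c → Certified[T, A, n, c])

/-! ## Small bridging lemmas on the real carrier -/

section Bridges

variable {X Y : Motives.SchemeOver ℂ}

/-- `g^*(xⁱ) = (g^*x)ⁱ` for the tree's pull-back `complexBetti.map` (naturality of cup powers).
[cite: HatcherAT2002, Prop. 3.10] -/
theorem complexBetti_map_cupPowTwo (g : X ⟶ Y) (x : complexBetti Y (2 * 1)) (i : ℕ) :
    complexBetti.map g (2 * i) (cupPowTwo x i) = cupPowTwo (complexBetti.map g (2 * 1) x) i :=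
  map_cupPowTwo _ x i

/-- `(e⁻¹)^* e^* y = y` on the cohomology of the target of `e : X ≅ Y`. [folklore] -/
theorem complexBetti_map_inv_map_hom (e : X ≅ Y) (k : ℕ) (y : complexBetti Y k) :
    complexBetti.map e.inv k (complexBetti.map e.hom k y) = y :=
  map_hom_map_inv_apply e.symm k y

/-- `e^*` along an isomorphism is injective on classes (apply `(e⁻¹)^*`). [folklore] -/
theorem complexBetti_map_hom_eq_zero_iff (e : X ≅ Y) (k : ℕ) (y : complexBetti Y k) :
    complexBetti.map e.hom k y = 0 ↔ y = 0 := by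
  refine ⟨fun h ↦ ?_, fun h ↦ by rw [h, map_zero]⟩
  have h' := congrArg (complexBetti.map e.inv k) h
  rwa [complexBetti_map_inv_map_hom, map_zero] at h'

/-- Element form of `(g ≫ h)^* = g^* ∘ h^*`. [cite: FultonYoungTableaux1997, Appendix B §B.1 (1)] -/
theorem complexBetti_map_comp_apply' {Z : Motives.SchemeOver ℂ} (g : X ⟶ Y) (h : Y ⟶ Z) (i : ℕ)
    (a : complexBetti Z i) :
    complexBetti.map (g ≫ h) i a = complexBetti.map g i (complexBetti.map h i a) := by
  rw [complexBetti.map_comp]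
  rfl

end Bridges

/-! ## The induced endomorphism of a fibre -/

section FibreEndo

variable {𝒳 S : Motives.SchemeOver ℂ}

/-- An `S`-endomorphism `u` of the total space (`u ≫ f = f`) restricts to an endomorphism `u_s` of
every fibre with `u_s ≫ ι_s = ι_s ≫ u` (universal property of the fibre product). [folklore] -/
theorem exists_fiberEndo (f : 𝒳 ⟶ S) (s : Motives.ComplexPoints S) (u : 𝒳 ⟶ 𝒳) (hu : u ≫ f = f) :
    ∃ us : Motives.fiberOver f s ⟶ Motives.fiberOver f s,
      us ≫ Motives.fiberι f s = Motives.fiberι f s ≫ u := by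
  have hcond : (pullback.fst f.left s.left ≫ u.left) ≫ f.left = pullback.snd f.left s.left ≫ s.left := by
    rw [Category.assoc, ← Over.comp_left, hu]
    exact pullback.condition
  refine ⟨Over.homMk (pullback.lift (pullback.fst f.left s.left ≫ u.left) (pullback.snd f.left s.left)
    hcond) ?_, ?_⟩
  · simp only [Motives.fiberOver]
    erw [pullback.lift_fst_assoc]
    erw [Category.assoc, Over.w u]
    rfl
  · ext : 1
    simp only [Motives.fiberι, Over.comp_left, Over.homMk_left]
    erw [pullback.lift_fst]

end FibreEndo


/-! ## The reduction -/

/-- **`stub_weilSectorSeeds` is false, granted four printed theorems** (sorry-free reduction; the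
statement negated is VERBATIM the registered stub `∃ T : ChernCharacterBetti, WeilSeeds[T]` of the
skeleton `Lines/symmetry-ladder-isotypic-obstructions.lean`). Hypotheses: `h₁` the no-go theorem for
`{0,1}`-semiregular sheaves (Buchweitz–Flenner Prop. 4.4 + Cor. 4.3 + the rigidity lemma, cdisprove
cycle 3, `Cruxes/HodgeAbelianVarieties/Disproof.lean` §11); `h₂` flatness of global classes over the
connected base of an `AVFamily`; `h₃` the hyperplane polarisation of an `AVFamily`; `h₄` a very
general Weil-type abelian sixfold with its Hodge ring `ℚ[θ] ⊕ W_K` in degrees `≤ 6`. PROOF (the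
transport argument of the cycle-3 note): at the very general fibre `s₁` the flat-Hodge classes
`G₁, G₂` of every seed and the hyperplane class are multiples of `θ, θ²`; flatness moves this to the
seed points `z_j`, where `h₁` makes `T.ch₃(E_j)` a multiple of `Θ³`; flatness moves that back to
`s₁`; endomorphism-translates and divisor cubes stay in `ℂθ³`; so the certified Weil class lies in
`ℂθ³ ∩ (E₊ ⊕ E₋) = 0`, contradicting `c ≠ 0`. [cite: BuchweitzFlenner2003, Cor. 4.3 and Prop. 4.4]
[cite: vanGeemen1994HodgeAV, Thm. 6.12] -/
theorem not_exists_weilSeeds_of_rigidity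
    (h₁ : ∀ (T : ChernCharacterBetti) (B : AbelianVariety ℂ) (X : Motives.SchemeOver ℂ) (_e : B.X ≅ X)
      (θ : complexBetti X 2), IsPolarizationClass B.dim X θ →
      ∀ (E : X.left.Modules) (hE : Motives.IsFiniteLocallyFree E), IsZeroOneSemiregular hE →
        (∃ a : ℂ, T.ch X E 1 = a • θ) → (∃ b : ℂ, T.ch X E 2 = b • cupPowTwo θ 2) →
          ∀ q : ℕ, ∃ c : ℂ, T.ch X E q = c • cupPowTwo θ q)
    (h₂ : ∀ ⦃𝒳 S : Motives.SchemeOver ℂ⦄ (f : 𝒳 ⟶ S) (n : ℕ), AVFamily[𝒳, S, f, n] →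
      ∀ (k : ℕ) (G : complexBetti 𝒳 k) (s₀ : Motives.ComplexPoints S),
        (Res[f, s₀, k, G] = 0 → ∀ s, Res[f, s, k, G] = 0) ∧
        (IsRationalClass (Res[f, s₀, k, G]) → ∀ s, IsRationalClass (Res[f, s, k, G])))
    (h₃ : ∀ ⦃𝒳 S : Motives.SchemeOver ℂ⦄ (f : 𝒳 ⟶ S) (n : ℕ), AVFamily[𝒳, S, f, n] → 0 < n →
      ∃ Θ : complexBetti 𝒳 (2 * 1), ∀ s,
        IsPolarizationClass n (Motives.fiberOver f s) (Res[f, s, 2 * 1, Θ]) ∧ Res[f, s, 2 * 1, Θ] ≠ 0)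
    (h₄ : ∃ (d : ℕ) (A : AbelianVariety ℂ) (φ : A ⟶ A) (c : complexBetti A.X (2 * 3))
      (θ : complexBetti A.X (2 * 1)),
      0 < d ∧ A.dim = 2 * 3 ∧ φ ≫ φ = -(d • 𝟙 A) ∧ c ∈ weilClassesOf A φ 3 d ∧ IsRationalClass c ∧
      IsOfHodgeType (2 * 3) A.X (2 * 3) 3 3 c ∧ c ≠ 0 ∧
      (∀ x : complexBetti A.X (2 * 1), IsRationalClass x →
        (IsOfHodgeType A.dim A.X (2 * 1) 1 1 x ∨ x ∈ algebraicClasses A.X 1) → ∃ a : ℂ, x = a • θ) ∧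
      (∀ x : complexBetti A.X (2 * 2), IsRationalClass x →
        IsOfHodgeType A.dim A.X (2 * 2) 2 2 x → ∃ b : ℂ, x = b • cupPowTwo θ 2) ∧
      (∀ u : A.X ⟶ A.X, ∃ a : ℂ, complexBetti.map u (2 * 1) θ = a • θ) ∧
      (∀ a : ℂ, a • cupPowTwo θ 3 ∈ weilClassesOf A φ 3 d → a • cupPowTwo θ 3 = 0)) :
    ¬ ∃ T : ChernCharacterBetti, WeilSeeds[T] := by
  rintro ⟨T, hT⟩
  obtain ⟨d, A, φ, c, θA, hd, hA, hφ, hcW, hcQ, hcH, hc0, hB1, hB2, hEnd, hdisj⟩ := h₄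
  obtain ⟨𝒳, S, f, s₁, e, W, hfam, -, hWc, r, z, G, hseed, hspan⟩ :=
    hT 3 d (by norm_num) hd A φ hA hφ c hcW hcQ hcH
  have hX : Motives.IsSmoothProjective A.dim A.X := AbelianVariety.isSmoothProjective_holds
  have hXs : ∀ s, Motives.IsSmoothProjective A.dim (Motives.fiberOver f s) :=
    fun s ↦ hfam.1.isSmoothProjective s
  obtain ⟨Θ, hΘ⟩ := h₃ f A.dim hfam (by rw [hA]; norm_num)
  have hflat0 : ∀ (k : ℕ) (G' : complexBetti 𝒳 k) (s₀ : Motives.ComplexPoints S),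
      Res[f, s₀, k, G'] = 0 → ∀ s, Res[f, s, k, G'] = 0 :=
    fun k G' s₀ ↦ (h₂ f A.dim hfam k G' s₀).1
  have hflatQ : ∀ (k : ℕ) (G' : complexBetti 𝒳 k) (s₀ : Motives.ComplexPoints S),
      IsRationalClass (Res[f, s₀, k, G']) → ∀ s, IsRationalClass (Res[f, s, k, G']) :=
    fun k G' s₀ ↦ (h₂ f A.dim hfam k G' s₀).2
  -- the hyperplane class at the very general fibre is `m θ`, `m ≠ 0`
  obtain ⟨m, hm⟩ : ∃ m : ℂ, complexBetti.map e.hom (2 * 1) (Res[f, s₁, 2 * 1, Θ]) = m • θA :=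
    hB1 (complexBetti.map e.hom (2 * 1) (Res[f, s₁, 2 * 1, Θ]))
      (IsRationalClass.map _ (hΘ s₁).1.isRationalClass)
      (Or.inr (mem_algebraicClasses_map_of_iso (hXs s₁) hX e (hΘ s₁).1.mem_algebraicClasses))
  have hm0 : m ≠ 0 := by
    rintro rfl
    rw [zero_smul, complexBetti_map_hom_eq_zero_iff] at hm
    exact (hΘ s₁).2 hm
  have hθA : θA = m⁻¹ • complexBetti.map e.hom (2 * 1) (Res[f, s₁, 2 * 1, Θ]) := by
    rw [hm, inv_smul_smul₀ hm0]
  -- transport: a global class which is `t θ^q` at `s₁` (read on `A`) is `t m^{-q} Θ^q` everywhere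
  have transport : ∀ (q : ℕ) (G' : complexBetti 𝒳 (2 * q)) (t : ℂ),
      complexBetti.map e.hom (2 * q) (Res[f, s₁, 2 * q, G']) = t • cupPowTwo θA q →
        ∀ s, Res[f, s, 2 * q, G'] = (t * (m⁻¹) ^ q) • Res[f, s, 2 * q, cupPowTwo Θ q] := by
    intro q G' t ht s
    have h0 : Res[f, s₁, 2 * q, G' - (t * (m⁻¹) ^ q) • cupPowTwo Θ q] = 0 := by
      rw [← complexBetti_map_hom_eq_zero_iff e, map_sub, map_sub, map_smul, map_smul, ht, hθA,
        Literature.AlgebraicGeometry.ModuliOfSheaves.cupPowTwo_smul, complexBetti_map_cupPowTwo,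
        complexBetti_map_cupPowTwo, smul_smul, sub_self]
    have h1 := hflat0 (2 * q) _ s₁ h0 s
    rwa [map_sub, map_smul, sub_eq_zero] at h1
  -- every seed class is a multiple of `Θ³`, fibrewise
  have hGj : ∀ j, ∃ cj : ℂ, ∀ s, Res[f, s, 2 * 3, G j] = cj • Res[f, s, 2 * 3, cupPowTwo Θ 3] := by
    intro j
    obtain ⟨E, hE, hsr, ⟨G₁, hG₁t, hch1⟩, ⟨G₂, hG₂t, hch2⟩, hchp⟩ := hseed j
    -- `G₁`
    have hr1 : IsRationalClass (Res[f, z j, 2 * 1, G₁]) := by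
      rw [← hch1]; exact T.isRationalClass_ch _ E hE.isVectorBundle 1
    obtain ⟨a, ha⟩ := hB1 (complexBetti.map e.hom (2 * 1) (Res[f, s₁, 2 * 1, G₁]))
      (IsRationalClass.map _ (hflatQ (2 * 1) G₁ (z j) hr1 s₁)) (Or.inl ((hG₁t s₁).map_of_iso e))
    have hG₁all := transport 1 G₁ a (by rw [cupPowTwo_one]; exact ha)
    have hE1 : ∃ a' : ℂ, T.ch (Motives.fiberOver f (z j)) E 1 = a' • Res[f, z j, 2 * 1, Θ] :=
      ⟨a * (m⁻¹) ^ 1, by rw [hch1, hG₁all (z j), cupPowTwo_one]⟩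
    -- `G₂`
    have hr2 : IsRationalClass (Res[f, z j, 2 * 2, G₂]) := by
      rw [← hch2]; exact T.isRationalClass_ch _ E hE.isVectorBundle 2
    obtain ⟨b, hb⟩ := hB2 (complexBetti.map e.hom (2 * 2) (Res[f, s₁, 2 * 2, G₂]))
      (IsRationalClass.map _ (hflatQ (2 * 2) G₂ (z j) hr2 s₁)) ((hG₂t s₁).map_of_iso e)
    have hG₂all := transport 2 G₂ b hb
    have hE2 : ∃ b' : ℂ, T.ch (Motives.fiberOver f (z j)) E 2 =
        b' • cupPowTwo (Res[f, z j, 2 * 1, Θ]) 2 :=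
      ⟨b * (m⁻¹) ^ 2, by rw [hch2, hG₂all (z j), complexBetti_map_cupPowTwo]⟩
    -- the no-go theorem on the fibre at `z j`
    obtain ⟨B, hBdim, ⟨eB⟩⟩ := hfam.2.2.2.2.2 (z j)
    have hpol : IsPolarizationClass B.dim (Motives.fiberOver f (z j)) (Res[f, z j, 2 * 1, Θ]) := by
      rw [hBdim]; exact (hΘ (z j)).1
    obtain ⟨cj, hcj⟩ := h₁ T B (Motives.fiberOver f (z j)) eB (Res[f, z j, 2 * 1, Θ]) hpol E hE hsr
      hE1 hE2 3
    have hzj : Res[f, z j, 2 * 3, G j] = cj • Res[f, z j, 2 * 3, cupPowTwo Θ 3] := by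
      rw [← hchp, hcj, complexBetti_map_cupPowTwo]
    refine ⟨cj, fun s ↦ ?_⟩
    have h0 : Res[f, z j, 2 * 3, G j - cj • cupPowTwo Θ 3] = 0 := by
      rw [map_sub, map_smul, hzj, sub_self]
    have h1 := hflat0 (2 * 3) _ (z j) h0 s
    rwa [map_sub, map_smul, sub_eq_zero] at h1
  -- every generator of the certifying span is a multiple of `θ³` at `s₁` (read on `A`)
  have key : ∀ x ∈ ({x : complexBetti 𝒳 (2 * 3) | ∃ (j : Fin r) (u : 𝒳 ⟶ 𝒳), u ≫ f = f ∧
        x = complexBetti.map u (2 * 3) (G j)} ∪ DivPow[𝒳, f, A.dim, 3]),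
      ∃ a : ℂ, complexBetti.map e.hom (2 * 3) (Res[f, s₁, 2 * 3, x]) = a • cupPowTwo θA 3 := by
    rintro x (⟨j, u, hu, rfl⟩ | ⟨h, hh, rfl⟩)
    · obtain ⟨cj, hcj⟩ := hGj j
      obtain ⟨us, hus⟩ := exists_fiberEndo f s₁ u hu
      obtain ⟨av, hav⟩ := hEnd (e.hom ≫ us ≫ e.inv)
      have step1 : Res[f, s₁, 2 * 3, complexBetti.map u (2 * 3) (G j)] =
          complexBetti.map us (2 * 3) (Res[f, s₁, 2 * 3, G j]) := by
        rw [← complexBetti_map_comp_apply', ← hus, complexBetti_map_comp_apply']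
      have step2 : complexBetti.map e.hom (2 * 1) (complexBetti.map us (2 * 1) (Res[f, s₁, 2 * 1, Θ])) =
          (m * av) • θA := by
        rw [← complexBetti_map_comp_apply',
          show e.hom ≫ us = (e.hom ≫ us ≫ e.inv) ≫ e.hom by simp, complexBetti_map_comp_apply', hm,
          map_smul, hav, smul_smul]
      refine ⟨cj * (m * av) ^ 3, ?_⟩
      rw [step1, hcj s₁, map_smul, map_smul, complexBetti_map_cupPowTwo, complexBetti_map_cupPowTwo,
        complexBetti_map_cupPowTwo, step2, Literature.AlgebraicGeometry.ModuliOfSheaves.cupPowTwo_smul,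
        smul_smul]
    · obtain ⟨a, ha⟩ := hB1 (complexBetti.map e.hom (2 * 1) (Res[f, s₁, 2 * 1, h]))
        (IsRationalClass.map _ (hh s₁).1) (Or.inl ((hh s₁).2.map_of_iso e))
      refine ⟨a ^ 3, ?_⟩
      rw [complexBetti_map_cupPowTwo, complexBetti_map_cupPowTwo, ha,
        Literature.AlgebraicGeometry.ModuliOfSheaves.cupPowTwo_smul]
  -- hence so is `W`, i.e. the Weil class `c`
  have hspanP : ∀ w ∈ Submodule.span ℂ ({x : complexBetti 𝒳 (2 * 3) | ∃ (j : Fin r) (u : 𝒳 ⟶ 𝒳),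
        u ≫ f = f ∧ x = complexBetti.map u (2 * 3) (G j)} ∪ DivPow[𝒳, f, A.dim, 3]),
      ∃ a : ℂ, complexBetti.map e.hom (2 * 3) (Res[f, s₁, 2 * 3, w]) = a • cupPowTwo θA 3 := by
    intro w hw
    induction hw using Submodule.span_induction with
    | mem x hx => exact key x hx
    | zero => exact ⟨0, by rw [map_zero, map_zero, zero_smul]⟩
    | add x y _ _ hx hy =>
      obtain ⟨a, ha⟩ := hx
      obtain ⟨b, hb⟩ := hy
      exact ⟨a + b, by rw [map_add, map_add, ha, hb, add_smul]⟩
    | smul t x _ hx =>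
      obtain ⟨a, ha⟩ := hx
      exact ⟨t * a, by rw [map_smul, map_smul, ha, smul_smul]⟩
  obtain ⟨a, ha⟩ := hspanP W hspan
  rw [hWc] at ha
  exact hc0 (ha.trans (hdisj a (ha ▸ hcW)))

end Summit.HodgeConjecture.HodgeConjecture.Theorems.HodgeAbelianVarieties.Negative

end
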